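import Summits.ABC.IUTFork.Cor312RegimeVerbatimPrVolExactCriterion
import Summits.ABC.IUTFork.Cor312HullGluedContainerPrintRadii
import HarnessLib

/-!
# [IUTchIII] Cor. 3.12 — the regime decomposition at the print-normalised sharp setting of record, V: the Θ-volume of
# the TRIVIAL configuration in PRINT's constants — `0 ≤ −|log(Θ)|(𝟙) ≤ PN_i Σ_{p | 2·disc F} (2 + B_{p,i} + M_{p,i})·log p`

PROOF-ONLY support piece of the abc-iut cell (Cor. 3.12 cone, D-0067; seat abc-iut-w4-d107, gen 5; part 15 of the
`Cor312NegLogThetaUpperPrVol*` / `Cor312RegimeVerbatimPrVol*` chain, sequel of parts 11–12; independent of parts 13–14).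
TAKES NO SIDE on
[IUTchIII] Cor. 3.12; theorems only, 0 `def`s, no new `Prop` fact, no instance.

Parts 11–14 reduced the typed Statement of [IUTchIII] Cor. 3.12 at `Real.settingPrVolSharp` to the local Θ-terms at
the bad primes and ONE datum-independent number, the Θ-volume `−|log(Θ)|(𝟙)` of the trivial (unit) idele configuration
— bounded in part 12 by an EXISTENTIAL sandwich constant `C₂(X, logv)`. THIS FILE makes the bound explicit in the
constants of [IUTchIV] Prop. 1.2 (`d_I`, `a_I`, `b_I`; abc-iut-w5-d082's print radii of the log-shell lattice,
`Cor312HullGluedContainerPrintRadii` p437145), with NO hypothesis on `S`: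

* `negLogTheta_settingPrVolSharp_trivial_le_of_radii'` — `−|log(Θ)|(𝟙) ≤ PN_i Σ_{p∈Bad} max(log(p²R_{p,i}/r_{p,i}), 0)`
  for ANY finite `Bad ⊇ {2} ∪ {p | disc F}` and sandwich radii `r, R` of `latticeF 1`, with NO hypothesis on `S`
  (part 12's `…_le_of_radii` asked the places of `S` to lie over odd unramified primes; for the TRIVIAL configuration
  this is irrelevant: at an odd unramified prime the local term of `𝟙` is `0` whether or not the prime is under `S`);
* **`negLogTheta_settingPrVolSharp_trivial_le_print`** — with print's radii `r_{p,i} = ‖(2p)^{−(i+2)}‖·p^{−M_{p,i}}`,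
  `R_{p,i} = ‖(2p)^{−(i+2)}‖·p^{B_{p,i}}` for any bounds `M_{p,i} ≥ ⌈d_{v⃗} + a_{v⃗}⌉`, `B_{p,i} ≥ b_{v⃗}` over the
  summands `v⃗` of the packet `(i+1, p)` ([IUTchIV] Prop. 1.2 (i)(ii)): the scalar cancels and
  `−|log(Θ)|(𝟙) ≤ PN_i Σ_{p∈Bad} max((2 + B_{p,i} + M_{p,i})·log p, 0)` — the Θ-volume of the trivial configuration,
  hence the shift in the exact criterion of parts 12/14, is at most an explicit sum over the primes `2` and `p | disc F`
  of print's different/ramification constants (feed: the HEX-KERNEL bricks `d + a + b ≤ 4 + 2·log_p[K_w : ℚ_p]`).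
HONEST SCOPE as in parts 7–14: (Ind2) as typed at the real setting (`Real.ismDH`); sharp (Ind3) reading; trivial
archimedean container; free ideles; nothing here asserts or denies [IUTchIII] Cor. 3.12 for initial Θ-data.
typed ≠ proved; instantiated ≠ endorsed. [claim: Mochizuki2012, status: disputed]
[cite: Mochizuki2012, IUTchIV Prop. 1.2 (i)(ii) p. 10] [cite: DupuyHilado2025, §3.9, §4.9, §4.10]
-/

noncomputable section

open Set Function NumberField IsDedekindDomain
open scoped Pointwise

namespace Summit.ABC

namespace IUTFork

namespace Thm311

namespace Real

open Cor312 Cor312.Setting Cor312Vol Literature.IUT.LogThetaLattice Literature.IUT.LogVolume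

variable {F : Type} [Field F] [NumberField F] (X : PilotData F) {logv : PadicLogs F} (hlog : LogvAnalytic logv)

section Print

variable (M : Type) [Field M] [NumberField M]
  (archPk : ∀ (j : (thetaIndex X).Label) (vQ : (thetaIndex X).VQ), Set ((logShellsDH X logv).Packet j vQ))
  (archSub : ∀ (j : (thetaIndex X).Label) (v : (thetaIndex X).V),
    Set ((logShellsDH X logv).Packet j ((thetaIndex X).over v)))
  (Ψ : ℤ → ∀ v : (thetaIndex X).V, v ∈ (thetaIndex X).Vbad → Set ((logShellsDH X logv).StarPacket v))
  (act : ℤ → ∀ v : (thetaIndex X).V, v ∈ (thetaIndex X).Vbad →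
    (logShellsDH X logv).StarPacket v → Module.End ℚ ((logShellsDH X logv).StarPacket v))
  (Mmod : ℤ → ∀ j : (thetaIndex X).LabelStar, Set ((logShellsDH X logv).GlobalPacket j.1))
  (region : ℤ → ∀ j : (thetaIndex X).LabelStar, FinDivisor M → ∀ vQ : (thetaIndex X).VQ,
    Set ((logShellsDH X logv).Packet j.1 vQ))
  (n : ℤ) {HT : Type} {LogLink : HT → HT → Type} {IsFull : ∀ {s t : HT}, LogLink s t → Prop}
  (lat : LGPGaussianLogThetaLattice LogLink IsFull)
  {Frd : Type} {IsoF : Frd → Frd → Type} {Ob : Frd → Type} {realify : Frd → Frd} {Strip : Type}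
  {IsoS : Strip → Strip → Type} {Mv : ∀ v : (thetaIndex X).V, v ∈ (thetaIndex X).Vbad → Type}
  [∀ v h, Monoid (Mv v h)]
  (sig : GlobalLGPFrobenioidSignature (thetaIndex X).lstar (thetaIndex X).V (· ∈ (thetaIndex X).Vbad)
    Frd IsoF Ob realify Strip IsoS Mv)
  (split : SplittingMonoids Mv) {ObΔ : Type} {N : ∀ v : (thetaIndex X).V, v ∈ (thetaIndex X).Vbad → Type}
  [∀ v h, Monoid (N v h)] (qData : QPilotData ObΔ N)

/-! ## §1. `−|log(Θ)|(𝟙) ≤ C₂` for every pilot datum (radii form, no hypothesis on `S`) -/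

/-- **`−|log(Θ)|(𝟙) ≤ PN_i Σ_{p∈Bad} max(log(p²R_{p,i}/r_{p,i}), 0)`** for ANY finite `Bad ⊇ {2} ∪ {p | disc F}` and
sandwich radii `r, R` of the log-shell lattices `latticeF 1`, with NO hypothesis on `S`: at an odd unramified prime the
local term of `𝟙` is `0` (part 11), at a prime of `Bad` it is at most part 1's crude polydisc bound (the unit box lies in
the unit polydisc), at `∞` it vanishes. [cite: DupuyHilado2025, §4.9, §4.10] -/
theorem negLogTheta_settingPrVolSharp_trivial_le_of_radii' (Bad : Finset Nat.Primes)
    (hBad2 : ∀ pp : Nat.Primes, (pp : ℕ) ≤ 2 → pp ∈ Bad)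
    (hBadD : ∀ pp : Nat.Primes, ((pp : ℕ) : ℤ) ∣ NumberField.discr F → pp ∈ Bad)
    (r R : Nat.Primes → Fin (thetaIndex X).lstar → ℝ) (hr0 : ∀ pp i, 0 < r pp i) (hR0 : ∀ pp i, 0 < R pp i)
    (hball : ∀ (pp : Nat.Primes) (i : Fin (thetaIndex X).lstar), haveI : Fact (pp : ℕ).Prime := ⟨pp.2⟩
      ∀ z : (∀ s : (presAt X hlog pp).factorIdx (labelSucc i), (presAt X hlog pp).factorField (labelSucc i) s),
        (∀ s, ‖z s‖ < r pp i) → z ∈ (presAt X hlog pp).latticeF (labelSucc i) 1)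
    (hbdd : ∀ (pp : Nat.Primes) (i : Fin (thetaIndex X).lstar), haveI : Fact (pp : ℕ).Prime := ⟨pp.2⟩
      ∀ z ∈ (presAt X hlog pp).latticeF (labelSucc i) 1, ∀ s, ‖z s‖ ≤ R pp i) :
    (settingPrVolSharp X hlog M archPk archSub Ψ act Mmod region n lat sig split qData (fun _ _ => 1) (fun _ _ _ => 1)
        (fun _ _ => one_ne_zero) (fun _ _ _ => norm_one)).negLogTheta ≤
      ((processionNormalized (fun i : Fin (thetaIndex X).lstar =>
          ∑ pp ∈ Bad, max (Real.log (((pp : ℕ) : ℝ) ^ 2 * R pp i / r pp i)) 0) : ℝ) : WithTop ℝ) := by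
  have hfinΘ₁ := thetaFinite_settingPrVolSharp X hlog M archPk archSub Ψ act Mmod region n lat sig split qData
    (fun _ _ _ => 1) (fun _ _ => 1) (fun _ _ _ => one_ne_zero) (fun _ _ _ _ => norm_one) (fun _ _ => one_ne_zero)
    (fun _ _ _ => norm_one)
  have H₁ := bridgeHyps_settingPrVolSharp_of_ideles X hlog M archPk archSub Ψ act Mmod region n lat sig split qData
    (fun _ _ _ => 1) (fun _ _ => 1) (fun _ _ _ => one_ne_zero) (fun _ _ _ _ => norm_one) (fun _ _ => one_ne_zero)
    (fun _ _ _ => norm_one)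
  unfold Setting.negLogTheta
  rw [if_pos hfinΘ₁, WithTop.coe_le_coe]
  refine processionNormalized_mono fun i => ?_
  -- the pointwise bound: the crude bound (clipped at `0`) on `Bad`, `0` elsewhere
  let b : (thetaIndex X).VQ → ℝ := fun vQ =>
    match vQ with
    | .inl _ => 0
    | .inr pp => if pp ∈ Bad then max (Real.log (((pp : ℕ) : ℝ) ^ 2 * R pp i / r pp i)) 0 else 0
  have hb_supp : (Function.support b) ⊆
      ((Bad.map ⟨(Sum.inr : Nat.Primes → (thetaIndex X).VQ), fun _ _ h => Sum.inr_injective h⟩ :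
        Finset (thetaIndex X).VQ) : Set (thetaIndex X).VQ) := by
    intro vQ hvQ
    rw [Function.mem_support] at hvQ
    rcases vQ with u | pp
    · exact absurd rfl hvQ
    · rw [Finset.coe_map, Set.mem_image]
      by_cases hpp : pp ∈ Bad
      · exact ⟨pp, Finset.mem_coe.mpr hpp, rfl⟩
      · exact absurd (by show b (.inr pp) = 0; exact if_neg hpp) hvQ
  have hb_fin : (Function.support b).Finite := (Finset.finite_toSet _).subset hb_supp
  have hpt : ∀ vQ : (thetaIndex X).VQ,
      ((settingPrVolSharp X hlog M archPk archSub Ψ act Mmod region n lat sig split qData (fun _ _ => 1)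
        (fun _ _ _ => 1) (fun _ _ => one_ne_zero) (fun _ _ _ => norm_one)).thetaLocal (labelSucc i) vQ).untopD 0 ≤
        b vQ := by
    intro vQ
    rcases vQ with u | pp
    · exact (thetaLocal_settingPrVol_untopD_inl X hlog M archPk archSub Ψ act Mmod region n lat sig split qData _ _ _ _
        u i H₁).le
    · haveI : Fact (pp : ℕ).Prime := ⟨pp.2⟩
      by_cases hpp : pp ∈ Bad
      · rw [show b (.inr pp) = max (Real.log (((pp : ℕ) : ℝ) ^ 2 * R pp i / r pp i)) 0 from if_pos hpp]
        refine le_trans ?_ (le_max_left _ _)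
        have h := thetaLocal_settingPrVol_untopD_le_of_polydisc X hlog M archPk archSub Ψ act Mmod region n lat sig
          split qData _ _ _ _ pp i (hr0 pp i) (hR0 pp i) one_pos (hball pp i) (hbdd pp i)
          (fun _ => thetaBoxDH_sharpBoxDH_subset_of_norm_le X hlog (fun _ _ _ => 1) (fun _ _ _ => one_ne_zero) pp i
            fun _ => norm_one.le) H₁
        rw [mul_one] at h
        exact h
      · rw [show b (.inr pp) = 0 from if_neg hpp]
        have hp2 : 2 < (pp : ℕ) := by
          by_contra h; exact hpp (hBad2 pp (not_lt.mp h))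
        have hdisc : ¬ ((pp : ℕ) : ℤ) ∣ NumberField.discr F := fun h => hpp (hBadD pp h)
        exact (thetaLocal_untopD_settingPrVolSharp_trivial_eq_zero X hlog M archPk archSub Ψ act Mmod region n lat sig
          split qData i pp hp2 hdisc).le
  refine (finsum_le_finsum' (hfinΘ₁.2 i) hb_fin hpt).trans (le_of_eq ?_)
  rw [finsum_eq_sum_of_support_subset b hb_supp, Finset.sum_map]
  exact Finset.sum_congr rfl fun pp hpp => if_pos hpp

/-! ## §2. `−|log(Θ)|(𝟙)` in PRINT's constants -/

/-- With print's radii the container term is `(2 + B + M)·log p`: `log(p²·(s·p^{B})/(s·p^{−M})) = (2 + B + M)·log p`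
for the scalar `s = ‖(2p)^{−(i+2)}‖ > 0`. [cite: Mochizuki2012, IUTchIV Prop. 1.2 (i)(ii) p. 10] -/
theorem log_sq_mul_print_radii (pp : Nat.Primes) {s : ℝ} (hs : 0 < s) (B : ℝ) (Mz : ℤ) :
    Real.log (((pp : ℕ) : ℝ) ^ 2 * (s * ((pp : ℕ) : ℝ) ^ B) / (s * ((pp : ℕ) : ℝ) ^ (-Mz))) =
      (2 + B + Mz) * Real.log (pp : ℕ) := by
  have hp0 : (0 : ℝ) < (pp : ℕ) := by exact_mod_cast pp.2.pos
  have hs0 : s ≠ 0 := hs.ne'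
  have hpz : ((pp : ℕ) : ℝ) ^ Mz ≠ 0 := zpow_ne_zero _ hp0.ne'
  have h1 : ((pp : ℕ) : ℝ) ^ 2 * (s * ((pp : ℕ) : ℝ) ^ B) / (s * ((pp : ℕ) : ℝ) ^ (-Mz)) =
      ((pp : ℕ) : ℝ) ^ ((2 : ℝ) + B + Mz) := by
    rw [Real.rpow_add hp0, Real.rpow_add hp0, Real.rpow_two, Real.rpow_intCast, zpow_neg]
    field_simp
  rw [h1, Real.log_rpow hp0]

/-- **THE Θ-VOLUME OF THE TRIVIAL CONFIGURATION IN PRINT'S CONSTANTS.** For EVERY pilot datum `X` (no hypothesis on `S`),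
every context, any finite `Bad ⊇ {2} ∪ {p | disc F}` and any bounds `M_{p,i} ≥ ⌈d_{v⃗} + a_{v⃗}⌉` (`mShellExp`),
`B_{p,i} ≥ b_{v⃗}` (`bSum`) over the summands `v⃗` of the packet `(i+1, p)` ([IUTchIV] Prop. 1.2 (i)(ii)):
`−|log(Θ)|(𝟙) ≤ PN_i Σ_{p∈Bad} max((2 + B_{p,i} + M_{p,i})·log p, 0)` — the sandwich radii of part 12's `C₂` taken to
be abc-iut-w5-d082's print radii `‖(2p)^{−(i+2)}‖·p^{−M_{p,i}} ⊆ latticeF 1 ⊆ ‖(2p)^{−(i+2)}‖·p^{B_{p,i}}`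
(`ball_subset_latticeF_one_print`, `norm_le_of_mem_latticeF_one_print`); the scalar `(2p)^{−(i+2)}` cancels. So the
shift in the exact criterion of parts 12/14 is at most an explicit sum, over the primes `2` and `p | disc F` only, of
print's different/ramification constants. [cite: Mochizuki2012, IUTchIV Prop. 1.2 (i)(ii) p. 10]
[cite: DupuyHilado2025, §4.9, §4.10] [claim: Mochizuki2012, status: disputed] -/
theorem negLogTheta_settingPrVolSharp_trivial_le_print (Bad : Finset Nat.Primes)
    (hBad2 : ∀ pp : Nat.Primes, (pp : ℕ) ≤ 2 → pp ∈ Bad)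
    (hBadD : ∀ pp : Nat.Primes, ((pp : ℕ) : ℤ) ∣ NumberField.discr F → pp ∈ Bad)
    (Mx : Nat.Primes → Fin (thetaIndex X).lstar → ℤ) (Bx : Nat.Primes → Fin (thetaIndex X).lstar → ℝ)
    (hM : ∀ (pp : Nat.Primes) (i : Fin (thetaIndex X).lstar)
      (e : (thetaIndex X).Caps (labelSucc i) → (thetaIndex X).Fibre (.inr pp)), haveI : Fact (pp : ℕ).Prime := ⟨pp.2⟩
      mShellExp (pp : ℕ) ((presAt X hlog pp).kk e) ≤ Mx pp i)
    (hB : ∀ (pp : Nat.Primes) (i : Fin (thetaIndex X).lstar)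
      (e : (thetaIndex X).Caps (labelSucc i) → (thetaIndex X).Fibre (.inr pp)), haveI : Fact (pp : ℕ).Prime := ⟨pp.2⟩
      bSum (pp : ℕ) ((presAt X hlog pp).kk e) ≤ Bx pp i) :
    (settingPrVolSharp X hlog M archPk archSub Ψ act Mmod region n lat sig split qData (fun _ _ => 1) (fun _ _ _ => 1)
        (fun _ _ => one_ne_zero) (fun _ _ _ => norm_one)).negLogTheta ≤
      ((processionNormalized (fun i : Fin (thetaIndex X).lstar =>
          ∑ pp ∈ Bad, max ((2 + Bx pp i + Mx pp i) * Real.log (pp : ℕ)) 0) : ℝ) : WithTop ℝ) := by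
  have hr : ∀ (pp : Nat.Primes) (i : Fin (thetaIndex X).lstar), haveI : Fact (pp : ℕ).Prime := ⟨pp.2⟩
      0 < ‖shellScalar (pp : ℕ) (I := (thetaIndex X).Caps (labelSucc i))‖ * ((pp : ℕ) : ℝ) ^ (-Mx pp i) := fun pp i => by
    haveI : Fact (pp : ℕ).Prime := ⟨pp.2⟩
    have hp0 : (0 : ℝ) < (pp : ℕ) := by exact_mod_cast pp.2.pos
    exact mul_pos (norm_pos_iff.2 (shellScalar_ne_zero (pp : ℕ))) (zpow_pos hp0 _)
  have hR : ∀ (pp : Nat.Primes) (i : Fin (thetaIndex X).lstar), haveI : Fact (pp : ℕ).Prime := ⟨pp.2⟩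
      0 < ‖shellScalar (pp : ℕ) (I := (thetaIndex X).Caps (labelSucc i))‖ * ((pp : ℕ) : ℝ) ^ Bx pp i := fun pp i => by
    haveI : Fact (pp : ℕ).Prime := ⟨pp.2⟩
    have hp0 : (0 : ℝ) < (pp : ℕ) := by exact_mod_cast pp.2.pos
    exact mul_pos (norm_pos_iff.2 (shellScalar_ne_zero (pp : ℕ))) (Real.rpow_pos_of_pos hp0 _)
  have h := negLogTheta_settingPrVolSharp_trivial_le_of_radii' X hlog M archPk archSub Ψ act Mmod region n lat sig split
    qData Bad hBad2 hBadD
    (fun pp i => haveI : Fact (pp : ℕ).Prime := ⟨pp.2⟩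
      ‖shellScalar (pp : ℕ) (I := (thetaIndex X).Caps (labelSucc i))‖ * ((pp : ℕ) : ℝ) ^ (-Mx pp i))
    (fun pp i => haveI : Fact (pp : ℕ).Prime := ⟨pp.2⟩
      ‖shellScalar (pp : ℕ) (I := (thetaIndex X).Caps (labelSucc i))‖ * ((pp : ℕ) : ℝ) ^ Bx pp i)
    hr hR
    (fun pp i => by
      haveI : Fact (pp : ℕ).Prime := ⟨pp.2⟩
      exact fun z hz => (presAt X hlog pp).ball_subset_latticeF_one_print (two_le_card_caps_labelSucc X i) (hM pp i) z hz)
    (fun pp i => by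
      haveI : Fact (pp : ℕ).Prime := ⟨pp.2⟩
      exact fun z hz s => (presAt X hlog pp).norm_le_of_mem_latticeF_one_print (hB pp i) z hz s)
  refine h.trans (le_of_eq ?_)
  congr 1
  refine congrArg processionNormalized (funext fun i => Finset.sum_congr rfl fun pp _ => ?_)
  haveI : Fact (pp : ℕ).Prime := ⟨pp.2⟩
  rw [log_sq_mul_print_radii pp (norm_pos_iff.2 (shellScalar_ne_zero (pp : ℕ))) (Bx pp i) (Mx pp i)]

end Print

end Real

end Thm311

end IUTFork

end Summit.ABC

end
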